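import Mathlib.Analysis.SpecialFunctions.Log.Basic
import HarnessLib

/-!
# `NoHeavyLowerTail` (stmt-CriticalPhenomena-4575) — support file: the SERIES and HUB steps of the logarithmic covariance bound
# (prover `prim-ineq-prove-2` gen 11; THEOREM S of MEMO-18 §9.2, THEOREM-SP.md §2, §5)

Pure real-variable inequalities; no definitions, no named facts, no sorries.  Companion of
`PercNearOneGluingNoHeavyLowerTailGZParallel.lean` (the parallel step).  Six-cell laws `(t, w, q, x, y, n)` of two-terminal hub networks
as there: `θ = t + w`, `Cov = (w+n)(t+q) − x·y`, `P(first terminal ↮ c) = w + n + x`, `P(second terminal ↮ c) = w + n + y`,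
`P(first isolated) = n + x`, `P(second isolated) = n + y`.

* `GZSeriesHub.series_cov_sub_mul_log_le` — SERIES composition of `N₁ = (a,m)` and `N₂ = (m,b)` at the cut vertex `m`:
  `θ = θ₁θ₂`, `w = w₁w₂`, `P(a↮c) = ā₁ + w₁·P₂(m↮c)`, `P(b↮c) = b̄₂ + w₂·P₁(m↮c)`, `P(a↮c, b↮c) = ā₁b̄₂ + w₁n₂ + n₁w₂ + w₁w₂`, and
  exactly `Cov = w₂Cov₁ + w₁Cov₂ − w₁w₂·P₁(m~c)·P₂(m~c)`; hence `Cov − w log(θ/w) ≤ w₂(Cov₁ − w₁log(θ₁/w₁)) + w₁(Cov₂ − w₂log(θ₂/w₂))`;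
* `GZSeriesHub.hub_cov_sub_mul_log_le` — HUB step (raising the hub edge at the first terminal by `γ`):
  `Cov′ = (1−γ)(Cov + γ·w·P(a↮c))`, `w′ = (1−γ)w`, `θ′ = θ`, hence `Cov′ − w′log(θ′/w′) ≤ (1−γ)(Cov − w log(θ/w))` (from `γ ≤ −log(1−γ)`).
Together with `GZParallel.parallel_cov_sub_mul_log_le` these are the three closure steps of THEOREM SP at the level of cell laws.
-/

noncomputable section

namespace Summit.CriticalPhenomena.PercolationContinuityZ3.Theorems

namespace GZSeriesHub

/-- **Series step (THEOREM S).**  Cells `(tᵢ, wᵢ, qᵢ, xᵢ, yᵢ, nᵢ)` of `N₁ = (a, m)` and `N₂ = (m, b)` (nonnegative, summing to one,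
`wᵢ > 0`); the series composite at `m` has `θ = θ₁θ₂`, `W = w₁w₂`, `U = (n₁+x₁) + w₁(w₂+n₂+x₂)`, `V = (n₂+y₂) + w₂(w₁+n₁+y₁)`,
`Z = (n₁+x₁)(n₂+y₂) + w₁n₂ + n₁w₂ + w₁w₂`, `C = Z − U·V`.  Then
`C − W log(θ/W) ≤ w₂(C₁ − w₁ log(θ₁/w₁)) + w₁(C₂ − w₂ log(θ₂/w₂))`, where `Cᵢ = (wᵢ+nᵢ)(tᵢ+qᵢ) − xᵢyᵢ`;
the slack is exactly `w₁w₂·(1 − (w₁+n₁+y₁))·(1 − (w₂+n₂+x₂)) = w₁w₂·P₁(m~c)·P₂(m~c) ≥ 0`. -/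
theorem series_cov_sub_mul_log_le {t₁ w₁ q₁ x₁ y₁ n₁ t₂ w₂ q₂ x₂ y₂ n₂ : ℝ}
    (ht₁ : 0 ≤ t₁) (hw₁ : 0 < w₁) (hq₁ : 0 ≤ q₁) (hx₁ : 0 ≤ x₁) (_hy₁ : 0 ≤ y₁) (_hn₁ : 0 ≤ n₁)
    (ht₂ : 0 ≤ t₂) (hw₂ : 0 < w₂) (hq₂ : 0 ≤ q₂) (_hx₂ : 0 ≤ x₂) (hy₂ : 0 ≤ y₂) (_hn₂ : 0 ≤ n₂)
    (hs₁ : t₁ + w₁ + q₁ + x₁ + y₁ + n₁ = 1) (hs₂ : t₂ + w₂ + q₂ + x₂ + y₂ + n₂ = 1) :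
    ((n₁ + x₁) * (n₂ + y₂) + w₁ * n₂ + n₁ * w₂ + w₁ * w₂ -
          ((n₁ + x₁) + w₁ * (w₂ + n₂ + x₂)) * ((n₂ + y₂) + w₂ * (w₁ + n₁ + y₁))) -
        w₁ * w₂ * Real.log ((t₁ + w₁) * (t₂ + w₂) / (w₁ * w₂)) ≤
      w₂ * (((w₁ + n₁) * (t₁ + q₁) - x₁ * y₁) - w₁ * Real.log ((t₁ + w₁) / w₁)) +
        w₁ * (((w₂ + n₂) * (t₂ + q₂) - x₂ * y₂) - w₂ * Real.log ((t₂ + w₂) / w₂)) := by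
  have hθ₁ : 0 < t₁ + w₁ := by linarith
  have hθ₂ : 0 < t₂ + w₂ := by linarith
  have hlog : Real.log ((t₁ + w₁) * (t₂ + w₂) / (w₁ * w₂)) =
      Real.log ((t₁ + w₁) / w₁) + Real.log ((t₂ + w₂) / w₂) := by
    rw [mul_div_mul_comm, Real.log_mul (by positivity) (by positivity)]
  rw [hlog]
  -- the exact series identity: C = w₂ C₁ + w₁ C₂ − w₁ w₂ (1 − v₁)(1 − u₂), after eliminating tᵢ
  have ht₁' : t₁ = 1 - w₁ - q₁ - x₁ - y₁ - n₁ := by linarith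
  have ht₂' : t₂ = 1 - w₂ - q₂ - x₂ - y₂ - n₂ := by linarith
  have key : (n₁ + x₁) * (n₂ + y₂) + w₁ * n₂ + n₁ * w₂ + w₁ * w₂ -
        ((n₁ + x₁) + w₁ * (w₂ + n₂ + x₂)) * ((n₂ + y₂) + w₂ * (w₁ + n₁ + y₁)) =
      w₂ * ((w₁ + n₁) * (t₁ + q₁) - x₁ * y₁) + w₁ * ((w₂ + n₂) * (t₂ + q₂) - x₂ * y₂) -
        w₁ * w₂ * ((1 - (w₁ + n₁ + y₁)) * (1 - (w₂ + n₂ + x₂))) := by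
    rw [ht₁', ht₂']; ring
  have hslack : 0 ≤ w₁ * w₂ * ((1 - (w₁ + n₁ + y₁)) * (1 - (w₂ + n₂ + x₂))) := by
    have h1 : 0 ≤ 1 - (w₁ + n₁ + y₁) := by linarith
    have h2 : 0 ≤ 1 - (w₂ + n₂ + x₂) := by linarith
    positivity
  rw [key]
  nlinarith [hslack]

/-- **Hub step.**  Raising the hub edge at the first terminal `a` by `γ ∈ [0,1)` maps the cells
`(t, w, q, x, y, n) ↦ (t + γw, (1−γ)w, q + γx, (1−γ)x, y + γn, (1−γ)n)`; the new covariance is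
`(1−γ)(Cov + γ·w·(w+n+x))` and `θ` is unchanged, so with `γ·(w+n+x) ≤ γ ≤ −log(1−γ)`:
`Cov′ − w′ log(θ/w′) ≤ (1−γ)·(Cov − w log(θ/w))`.  In particular `Cov ≤ w log(θ/w) ⟹ Cov′ ≤ w′ log(θ′/w′)`. -/
theorem hub_cov_sub_mul_log_le {t w q x y n γ : ℝ}
    (ht : 0 ≤ t) (hw : 0 < w) (hq : 0 ≤ q) (_hx : 0 ≤ x) (hy : 0 ≤ y) (_hn : 0 ≤ n)
    (hs : t + w + q + x + y + n = 1) (hγ0 : 0 ≤ γ) (hγ1 : γ < 1) :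
    (((1 - γ) * w + (1 - γ) * n) * ((t + γ * w) + (q + γ * x)) - ((1 - γ) * x) * (y + γ * n)) -
        (1 - γ) * w * Real.log ((t + γ * w + (1 - γ) * w) / ((1 - γ) * w)) ≤
      (1 - γ) * (((w + n) * (t + q) - x * y) - w * Real.log ((t + w) / w)) := by
  have h1γ : 0 < 1 - γ := by linarith
  have hθ : 0 < t + w := by linarith
  -- θ′ = θ
  have hθ' : t + γ * w + (1 - γ) * w = t + w := by ring
  rw [hθ']
  -- log(θ/((1−γ)w)) = log(θ/w) − log(1−γ)
  have hlog : Real.log ((t + w) / ((1 - γ) * w)) = Real.log ((t + w) / w) - Real.log (1 - γ) := by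
    rw [show (t + w) / ((1 - γ) * w) = ((t + w) / w) / (1 - γ) by field_simp]
    rw [Real.log_div (by positivity) (by positivity)]
  rw [hlog]
  -- −log(1−γ) ≥ γ
  have hlg : Real.log (1 - γ) ≤ -γ := by
    have := Real.log_le_sub_one_of_pos h1γ
    linarith
  -- Cov′ = (1−γ)(Cov + γ w u), u = w + n + x ≤ 1
  have hu : w + n + x ≤ 1 := by linarith
  have key : ((1 - γ) * w + (1 - γ) * n) * ((t + γ * w) + (q + γ * x)) - ((1 - γ) * x) * (y + γ * n) =
      (1 - γ) * (((w + n) * (t + q) - x * y) + γ * w * (w + n + x)) := by ring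
  rw [key]
  have h2 : γ * w * (w + n + x) ≤ γ * w := mul_le_of_le_one_right (by positivity) hu
  have h3 : (1 - γ) * w * Real.log (1 - γ) ≤ (1 - γ) * w * (-γ) := by
    exact mul_le_mul_of_nonneg_left hlg (by positivity)
  nlinarith [h2, h3, h1γ, hw]

end GZSeriesHub

end Summit.CriticalPhenomena.PercolationContinuityZ3.Theorems
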